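import Mathlib
import HarnessLib
import Summits.Parity.Statement
import Summits.Parity.BatemanHorn.Theses.OneSidedDegreeLadder

/-!
# Assembly of route-Parity-OneSidedDegreeLadder (item stmt-Parity-25179)

`Assembly : LinearCell → UpperNonlinear → LowerNonlinear → BatemanHorn` is literally the route's certified deciding theorem `closes`
(node B1 «OneSidedDegreeLadder» (record BH-side route, decomp-parity lens-1; rev 1)): the linear cell and the two one-sided nonlinear halves give BH system by system.  One line; no mathematics beyond the route file.
-/

namespace Summit.Parity.BatemanHorn.Theses.OneSidedDegreeLadder

/-- Assembly item stmt-Parity-25179 of route-Parity-OneSidedDegreeLadder: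
`LinearCell → UpperNonlinear → LowerNonlinear → BatemanHorn`,
by the route's deciding theorem `closes`. -/
theorem assembly_proof : Assembly :=
  fun h1 h2 h3 => closes h1 h2 h3

end Summit.Parity.BatemanHorn.Theses.OneSidedDegreeLadder
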